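import Summits.Ventures.HodgeKum4.Theorems.KummerFixedLocusHilbertKummerTransferAlgebra
import Literature.AlgebraicGeometry.HodgeTheory.TotalCohomologyKunneth
import Literature.AlgebraicGeometry.HilbertScheme.TranslationActionCohomology
import Literature.AlgebraicGeometry.Hyperkaehler.GeneralizedKummerPullbackInvariants
import Literature.AlgebraicTopology.SingularHomology.FreeActionLefschetzNumber
import HarnessLib

/-!
# V0 (`HilbertKummerTransfer`) — the transfer package of Beauville's Galois cover `Θ : A × Kⁿ(A) → A^[n+1]`
# (cell `hodge-kum4`, lane (V), seat p2)

Route `KummerFixedLocus`, item `HilbertKummerTransfer` (stmt-Ventures-20142).  HONEST FRAMING: helper theorems; the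
Galois cover enters as DATA (a `FiniteDeckCover` on complex points whose projection is `Θ(ℂ)` and whose deck
transformations are `(t_{b⁻¹} × τ)(ℂ)` — exactly what the REFEREED fact
`HilbertScheme.Beauville1983_kummerCover_galois` (F6) provides); nothing about V0, L1 or the Hodge conjecture is
proved in this file.

Notation: `κ = HodgeTheory.kunnethCross A.X K : H*(A) ⊗ H*(K) → H*((A × K)(ℂ))` (`a ⊗ b ↦ fst^*a ∪ snd^*b`, an
isomorphism for `K` smooth projective: `HodgeTheory.kunnethEquiv`), `Θ^* = totalPullback ℂ Θ(ℂ)`,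
`θ^* = totalPullback ℂ j(ℂ)` for the Kummer fibre `j : K ⟶ H`.

* §1 plumbing: components of `f^*` (`component_totalPullback`), injectivity and deck-invariant range of `Θ^*` on the
  TOTAL cohomology from the tree's degreewise transfer (`FiniteDeckCover.map_proj_injective_of_card_ne_zero`,
  `mem_range_map_proj_iff`): **`totalPullback_proj_injective`**, **`mem_range_totalPullback_proj_iff`**,
  `exists_ofDegree_preimage` (a deck-invariant HOMOGENEOUS class is `Θ^*` of a homogeneous class).
* §2 the deck transformations act on cross products through the `K`-factor only:
  **`totalPullback_deck_kunnethCross`** `d_g^* (κ x) = κ ((id ⊗ τ_g^*) x)` (translations act trivially on `H*(A(ℂ))`,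
  `AbelianVariety.complexBetti_map_translate`).
* §3 **`fibreRange`** `R = {s ∈ H*(K) | κ(1 ⊗ s) ∈ im Θ^*}` and **`range_totalPullback_proj_eq`**:
  `im Θ^* = κ(H*(A) ⊗ R)` (`⊇`: `im Θ^*` is a subring containing `fst^* H*(A)`; `⊆`: the dual-functional criterion
  `HilbertKummer.mem_tensorWith_iff` — for `v = κ t ∈ im Θ^*` every contraction `(φ ⊗ id) t` lies in `R`).
* §4 **`fibreRange_eq_range`**: `R = im θ^*` (`θ = Θ ∘ (1, 𝟙_K)`, v0typer's
  `IsTranslationAction.totalPullback_sliceOne_comp_kummerCover`, and the slice lemmas of `TotalCohomologyKunneth`).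
-/

noncomputable section

open CategoryTheory MonoidalCategory CartesianMonoidalCategory DirectSum TensorProduct
open Literature.AlgebraicTopology.SingularHomology
open Literature.AlgebraicGeometry Literature.AlgebraicGeometry.Motives Literature.AlgebraicGeometry.Hyperkaehler
open Literature.AlgebraicGeometry.HilbertScheme Literature.AlgebraicGeometry.HodgeTheory

namespace Summit.Ventures.HodgeKum4.HilbertKummer

open scoped MonObj


/-! ### §1 Plumbing: components of pull-backs; transfer on the total cohomology -/

section Plumbing

variable {Y Y' : Type} [TopologicalSpace Y] [TopologicalSpace Y']

/-- Components of a pull-back: `(f^* v)_k = f^*_k (v_k)`. -/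
theorem component_totalPullback (f : C(Y, Y')) (k : ℕ) (v : totalCohomology ℂ Y') :
    DirectSum.component ℂ ℕ (fun i ↦ (singularCohomology ℂ ℂ Y i : Type)) k (totalPullback ℂ f v) =
      singularCohomology.map ℂ ℂ f k (DirectSum.component ℂ ℕ (fun i ↦ (singularCohomology ℂ ℂ Y' i : Type)) k v) := by
  classical
  induction v using DirectSum.induction_on with
  | zero => simp only [map_zero]
  | add x y hx hy => simp only [map_add, hx, hy]
  | of i x =>
    rw [← lof_eq_of ℂ]
    change DirectSum.component ℂ ℕ _ k (totalPullback ℂ f (ofDegree ℂ Y' i x)) = _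
    rw [totalPullback_lof]
    by_cases hik : i = k
    · subst hik
      rw [DirectSum.component.lof_self (R := ℂ) (M := fun i ↦ (singularCohomology ℂ ℂ Y' i : Type)),
        DirectSum.component.lof_self (R := ℂ) (M := fun i ↦ (singularCohomology ℂ ℂ Y i : Type))]
    · rw [DirectSum.component.of (R := ℂ) (M := fun i ↦ (singularCohomology ℂ ℂ Y i : Type)),
        DirectSum.component.of (R := ℂ) (M := fun i ↦ (singularCohomology ℂ ℂ Y' i : Type)),
        dif_neg hik, dif_neg hik, map_zero]

variable {G : Type} [Group G] [Fintype G] [MulAction G Y] (c : FiniteDeckCover G Y Y')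

/-- `|G| ≠ 0` in `ℂ`. -/
theorem card_ne_zero : (Fintype.card G : ℂ) ≠ 0 :=
  Nat.cast_ne_zero.2 Fintype.card_ne_zero

/-- **`p^*` is injective on the total cohomology** `H*(Y'; ℂ) → H*(Y; ℂ)` for a finite regular cover `p : Y → Y'`
(the tree's degreewise `FiniteDeckCover.map_proj_injective_of_card_ne_zero`). -/
theorem totalPullback_proj_injective : Function.Injective (totalPullback ℂ c.proj) := by
  intro v w hvw
  refine DirectSum.ext_component ℂ fun k ↦ ?_
  apply c.map_proj_injective_of_card_ne_zero ℂ card_ne_zero k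
  rw [← component_totalPullback, ← component_totalPullback, hvw]

/-- `g^* (p^* x) = p^* x` on the total cohomology. -/
theorem totalPullback_deck_totalPullback_proj (g : G) (x : totalCohomology ℂ Y') :
    totalPullback ℂ (c.deck g) (totalPullback ℂ c.proj x) = totalPullback ℂ c.proj x := by
  rw [← LinearMap.comp_apply, ← totalPullback_comp]
  congr 2
  exact ContinuousMap.ext fun e ↦ c.proj_smul g e

/-- **The range of `p^*` on the total cohomology is the deck-invariant classes** (degreewise: Hatcher Prop. 3G.1,
the tree's `FiniteDeckCover.mem_range_map_proj_iff`). -/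
theorem mem_range_totalPullback_proj_iff (v : totalCohomology ℂ Y) :
    v ∈ LinearMap.range (totalPullback ℂ c.proj) ↔ ∀ g : G, totalPullback ℂ (c.deck g) v = v := by
  classical
  constructor
  · rintro ⟨x, rfl⟩ g
    exact totalPullback_deck_totalPullback_proj c g x
  · intro hv
    -- each component is deck-invariant, hence a pull-back
    have hk : ∀ k, ∃ x : singularCohomology ℂ ℂ Y' k, singularCohomology.map ℂ ℂ c.proj k x =
        DirectSum.component ℂ ℕ (fun i ↦ (singularCohomology ℂ ℂ Y i : Type)) k v := by
      intro k
      have h1 : DirectSum.component ℂ ℕ (fun i ↦ (singularCohomology ℂ ℂ Y i : Type)) k v ∈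
          Set.range (singularCohomology.map ℂ ℂ c.proj k) := by
        rw [c.mem_range_map_proj_iff ℂ card_ne_zero k]
        intro g
        rw [← component_totalPullback, hv g]
      exact h1
    choose x hx using hk
    refine ⟨∑ k ∈ v.support, ofDegree ℂ Y' k (x k), ?_⟩
    rw [map_sum]
    conv_rhs => rw [← DirectSum.sum_support_of v]
    refine Finset.sum_congr rfl fun k _ ↦ ?_
    rw [totalPullback_lof, hx k, ← lof_eq_of ℂ]
    rfl

/-- A deck-invariant HOMOGENEOUS class is the pull-back of a homogeneous class of the same degree. -/
theorem exists_ofDegree_preimage {k : ℕ} (z : singularCohomology ℂ ℂ Y k)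
    (hz : ofDegree ℂ Y k z ∈ LinearMap.range (totalPullback ℂ c.proj)) :
    ∃ w : singularCohomology ℂ ℂ Y' k, totalPullback ℂ c.proj (ofDegree ℂ Y' k w) = ofDegree ℂ Y k z := by
  classical
  rw [mem_range_totalPullback_proj_iff] at hz
  have h1 : z ∈ Set.range (singularCohomology.map ℂ ℂ c.proj k) := by
    rw [c.mem_range_map_proj_iff ℂ card_ne_zero k]
    intro g
    have h2 := congrArg (DirectSum.component ℂ ℕ (fun i ↦ (singularCohomology ℂ ℂ Y i : Type)) k) (hz g)
    rwa [component_totalPullback,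
      DirectSum.component.lof_self (R := ℂ) (M := fun i ↦ (singularCohomology ℂ ℂ Y i : Type))] at h2
  obtain ⟨w, hw⟩ := h1
  exact ⟨w, by rw [totalPullback_lof, hw]⟩

end Plumbing

/-! ### §2 The deck transformations of the Kummer cover act through the `K`-factor -/

section Deck

variable {A : AbelianVariety ℂ} {K H : SchemeOver ℂ}

/-- **`t_b^* = id` on the total cohomology `H*(A(ℂ); ℂ)`** (translations of a connected group; the tree's
`AbelianVariety.complexBetti_map_translate` degreewise). -/
theorem totalPullback_translate (b : 𝟙_ (SchemeOver ℂ) ⟶ A.X) :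
    totalPullback ℂ (AlgPoints.mapContinuous (L := ℂ) (A.translate b)) = LinearMap.id := by
  refine DirectSum.linearMap_ext ℂ fun k ↦ LinearMap.ext fun x ↦ ?_
  simp only [LinearMap.coe_comp, Function.comp_apply, totalPullback_lof, LinearMap.id_coe, id_eq]
  exact congrArg _ (AbelianVariety.complexBetti_map_translate_apply b k x)

/-- **A product map `(t_b × τ)(ℂ)` acts on cross products by `κ ∘ (id ⊗ τ^*)`**: `(t_b × τ)^*(a × s) = a × τ^* s`. -/
theorem totalPullback_translate_tensorHom_kunnethCross (b : 𝟙_ (SchemeOver ℂ) ⟶ A.X) (τ : K ⟶ K)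
    (x : totalCohomology ℂ (ComplexPoints A.X) ⊗[ℂ] totalCohomology ℂ (ComplexPoints K)) :
    totalPullback ℂ (AlgPoints.mapContinuous (L := ℂ) (A.translate b ⊗ₘ τ)) (kunnethCross A.X K x) =
      kunnethCross A.X K ((totalPullback ℂ (AlgPoints.mapContinuous (L := ℂ) τ)).lTensor _ x) := by
  rw [totalPullback_tensorHom_kunnethCross, totalPullback_translate]
  rfl

variable {G : Type} [Group G] [Fintype G] [MulAction G (ComplexPoints (A.X ⊗ K))]
  (c : FiniteDeckCover G (ComplexPoints (A.X ⊗ K)) (ComplexPoints H))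
  (hdeck : ∀ g : G, ∃ (b : 𝟙_ (SchemeOver ℂ) ⟶ A.X) (τ : K ⟶ K),
    c.deck g = AlgPoints.mapContinuous (L := ℂ) (A.translate b⁻¹ ⊗ₘ τ))

include hdeck in
/-- **The deck transformations of Beauville's cover act on `κ(H*(A) ⊗ H*(K))` through the `K`-factor**:
`d_g^* (κ x) = κ ((id ⊗ τ_g^*) x)` for the Kummer translation `τ_g` of `g`. -/
theorem exists_totalPullback_deck_kunnethCross (g : G) :
    ∃ τ : K ⟶ K, ∀ x, totalPullback ℂ (c.deck g) (kunnethCross A.X K x) =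
      kunnethCross A.X K ((totalPullback ℂ (AlgPoints.mapContinuous (L := ℂ) τ)).lTensor _ x) := by
  obtain ⟨b, τ, hg⟩ := hdeck g
  exact ⟨τ, fun x ↦ by rw [hg, totalPullback_translate_tensorHom_kunnethCross]⟩

end Deck

/-! ### §3 `R = {s | 1 × s ∈ im Θ^*}` and `im Θ^* = κ(H*(A) ⊗ R)` -/

section FibreRange

variable (A : AbelianVariety ℂ) (K : SchemeOver ℂ) {H : SchemeOver ℂ}

/-- **The classes of `K` whose cross product with `1` is a pull-back from `H`**:
`R = {s ∈ H*(K(ℂ); ℂ) | 1 × s ∈ im Θ^*}` for a morphism `Θ : A × K ⟶ H` (for Beauville's cover this is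
`H*(K)^{A[n+1]} = im θ^*`, `fibreRange_eq_range`). -/
def fibreRange (Θ : A.X ⊗ K ⟶ H) : Submodule ℂ (totalCohomology ℂ (ComplexPoints K)) :=
  (LinearMap.range (totalPullback ℂ (AlgPoints.mapContinuous (L := ℂ) Θ))).comap
    (kunnethCross A.X K ∘ₗ TensorProduct.mk ℂ _ _
      (ofDegree ℂ (ComplexPoints A.X) 0 (singularCohomology.one ℂ (ComplexPoints A.X))))

variable {A K}

/-- Membership in `fibreRange`. -/
theorem mem_fibreRange_iff (Θ : A.X ⊗ K ⟶ H) (s : totalCohomology ℂ (ComplexPoints K)) :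
    s ∈ fibreRange A K Θ ↔ kunnethCross A.X K
      (ofDegree ℂ (ComplexPoints A.X) 0 (singularCohomology.one ℂ (ComplexPoints A.X)) ⊗ₜ s) ∈
        LinearMap.range (totalPullback ℂ (AlgPoints.mapContinuous (L := ℂ) Θ)) := by
  simp [fibreRange]

/-- `1 ∈ R`. -/
theorem one_mem_fibreRange (Θ : A.X ⊗ K ⟶ H) :
    ofDegree ℂ (ComplexPoints K) 0 (singularCohomology.one ℂ (ComplexPoints K)) ∈ fibreRange A K Θ := by
  rw [mem_fibreRange_iff, totalCross_one_tmul_one]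
  exact ⟨ofDegree ℂ (ComplexPoints H) 0 (singularCohomology.one ℂ _), by
    rw [totalPullback_lof, singularCohomology.map_one]⟩

variable {G : Type} [Group G] [Fintype G] [MulAction G (ComplexPoints (A.X ⊗ K))]
  (c : FiniteDeckCover G (ComplexPoints (A.X ⊗ K)) (ComplexPoints H)) {Θ : A.X ⊗ K ⟶ H}
  (hc : c.proj = AlgPoints.mapContinuous (L := ℂ) Θ)
  (hdeck : ∀ g : G, ∃ (b : 𝟙_ (SchemeOver ℂ) ⟶ A.X) (τ : K ⟶ K),
    c.deck g = AlgPoints.mapContinuous (L := ℂ) (A.translate b⁻¹ ⊗ₘ τ))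

include hc hdeck in
/-- `fst^* a = a × 1 ∈ im Θ^*` for every `a ∈ H*(A)` (deck-invariant: `(t × τ)^*(a × 1) = a × τ^*1 = a × 1`). -/
theorem kunnethCross_tmul_one_mem_range (a : totalCohomology ℂ (ComplexPoints A.X)) :
    kunnethCross A.X K (a ⊗ₜ ofDegree ℂ (ComplexPoints K) 0 (singularCohomology.one ℂ (ComplexPoints K))) ∈
      LinearMap.range (totalPullback ℂ (AlgPoints.mapContinuous (L := ℂ) Θ)) := by
  rw [← hc, mem_range_totalPullback_proj_iff]
  intro g
  obtain ⟨τ, hτ⟩ := exists_totalPullback_deck_kunnethCross c hdeck g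
  rw [hτ, LinearMap.lTensor_tmul, totalPullback_lof, singularCohomology.map_one]

include hc hdeck in
/-- **`im Θ^* ⊇ κ(H*(A) ⊗ R)`** (`im Θ^*` is a subring containing `a × 1` and `1 × s`, `s ∈ R`, and
`(a × 1) ⌣ (1 × s) = a × s`). -/
theorem map_tensorWith_fibreRange_le :
    (tensorWith (totalCohomology ℂ (ComplexPoints A.X)) (fibreRange A K Θ)).map (kunnethCross A.X K) ≤
      LinearMap.range (totalPullback ℂ (AlgPoints.mapContinuous (L := ℂ) Θ)) := by
  rw [Submodule.map_le_iff_le_comap, tensorWith]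
  refine Submodule.span_le.2 ?_
  rintro _ ⟨a, s, hs, rfl⟩
  change kunnethCross A.X K (a ⊗ₜ s) ∈ LinearMap.range (totalPullback ℂ (AlgPoints.mapContinuous (L := ℂ) Θ))
  rw [← totalCup_totalCross_tmul_one_one_tmul]
  obtain ⟨v, hv⟩ := kunnethCross_tmul_one_mem_range c hc hdeck a
  obtain ⟨w, hw⟩ := (mem_fibreRange_iff Θ s).1 hs
  refine ⟨totalCup ℂ _ v w, ?_⟩
  rw [totalPullback_totalCup, hv, hw]

include hc hdeck in
/-- **`im Θ^* ⊆ κ(H*(A) ⊗ R)`** for `K` smooth projective (so that `κ` is an isomorphism): for `v = κ t ∈ im Θ^*` and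
every functional `φ` on `H*(A)`, `1 × (φ ⊗ id) t` is deck-invariant (`d_g^* ∘ κ = κ ∘ (id ⊗ τ_g^*)` and
`(φ ⊗ id) ∘ (id ⊗ τ^*) = τ^* ∘ (φ ⊗ id)`), so `(φ ⊗ id) t ∈ R`; conclude by `mem_tensorWith_iff`. -/
theorem range_le_map_tensorWith_fibreRange {m : ℕ} (hA : IsSmoothProjective 2 A.X) (hK : IsSmoothProjective m K) :
    LinearMap.range (totalPullback ℂ (AlgPoints.mapContinuous (L := ℂ) Θ)) ≤
      (tensorWith (totalCohomology ℂ (ComplexPoints A.X)) (fibreRange A K Θ)).map (kunnethCross A.X K) := by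
  haveI := finite_totalCohomology hA
  intro v hv
  -- `v = κ t`
  obtain ⟨t, rfl⟩ : ∃ t, kunnethCross A.X K t = v := kunnethCross_surjective hA hK v
  refine ⟨t, ?_, rfl⟩
  rw [SetLike.mem_coe, mem_tensorWith_iff]
  intro φ
  rw [mem_fibreRange_iff, ← hc, mem_range_totalPullback_proj_iff]
  intro g
  obtain ⟨τ, hτ⟩ := exists_totalPullback_deck_kunnethCross c hdeck g
  rw [hτ, LinearMap.lTensor_tmul, ← contract_lTensor]
  -- `(id ⊗ τ^*) t = t` because `κ` is injective and `κ((id ⊗ τ^*) t) = d_g^* (κ t) = κ t`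
  have hinv : totalPullback ℂ (c.deck g) (kunnethCross A.X K t) = kunnethCross A.X K t := by
    rw [← hc] at hv
    exact ((mem_range_totalPullback_proj_iff c _).1 hv) g
  have ht : (totalPullback ℂ (AlgPoints.mapContinuous (L := ℂ) τ)).lTensor _ t = t :=
    (kunnethCross_bijective hA hK).1 (by rw [← hτ, hinv])
  rw [ht]

include hc hdeck in
/-- **`im Θ^* = κ(H*(A) ⊗ R)`.** -/
theorem range_totalPullback_eq {m : ℕ} (hA : IsSmoothProjective 2 A.X) (hK : IsSmoothProjective m K) :
    LinearMap.range (totalPullback ℂ (AlgPoints.mapContinuous (L := ℂ) Θ)) =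
      (tensorWith (totalCohomology ℂ (ComplexPoints A.X)) (fibreRange A K Θ)).map (kunnethCross A.X K) :=
  le_antisymm (range_le_map_tensorWith_fibreRange c hc hdeck hA hK) (map_tensorWith_fibreRange_le c hc hdeck)

include hc hdeck in
/-- Reformulation through the Künneth isomorphism: `Θ^* w ∈ im Θ^*` has `κ⁻¹ (Θ^* w) ∈ H*(A) ⊗ R`. -/
theorem kunnethEquiv_symm_mem_tensorWith {m : ℕ} (hA : IsSmoothProjective 2 A.X) (hK : IsSmoothProjective m K)
    {v : totalCohomology ℂ (ComplexPoints (A.X ⊗ K))}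
    (hv : v ∈ LinearMap.range (totalPullback ℂ (AlgPoints.mapContinuous (L := ℂ) Θ))) :
    (kunnethEquiv hA hK).symm v ∈ tensorWith (totalCohomology ℂ (ComplexPoints A.X)) (fibreRange A K Θ) := by
  obtain ⟨t, ht, rfl⟩ := range_le_map_tensorWith_fibreRange c hc hdeck hA hK hv
  have : (kunnethEquiv hA hK).symm (kunnethCross A.X K t) = t :=
    (kunnethEquiv hA hK).injective (by rw [LinearEquiv.apply_symm_apply, kunnethEquiv_apply])
  rwa [this]

end FibreRange

/-! ### §4 `R = im θ^*` -/

section FibreRangeEqRange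

variable {A : AbelianVariety ℂ} {K H : SchemeOver ℂ} {n : ℕ} {Ξ : (A.X ⊗ H).left.IdealSheafData}
  {act : A.X ⊗ H ⟶ H} {j : K ⟶ H}
  {G : Type} [Group G] [Fintype G] [MulAction G (ComplexPoints (A.X ⊗ K))]
  (c : FiniteDeckCover G (ComplexPoints (A.X ⊗ K)) (ComplexPoints H))
  (hc : c.proj = AlgPoints.mapContinuous (L := ℂ) (kummerCover act j))
  (hdeck : ∀ g : G, ∃ (b : 𝟙_ (SchemeOver ℂ) ⟶ A.X) (τ : K ⟶ K),
    c.deck g = AlgPoints.mapContinuous (L := ℂ) (A.translate b⁻¹ ⊗ₘ τ))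

/-- `θ^* = (1, 𝟙_K)^* ∘ Θ^*` on the total cohomology, with the slice written as `Motives.sliceRight 1 K`
(v0typer's `IsTranslationAction.totalPullback_sliceOne_comp_kummerCover`; `t_1^{[n]} = 𝟙`). -/
theorem totalPullback_eq_sliceRight_comp (hH : IsHilbertSchemeOfPoints n A.X H Ξ) (hact : IsTranslationAction Ξ act)
    (j : K ⟶ H) :
    totalPullback ℂ (AlgPoints.mapContinuous (L := ℂ) j) =
      totalPullback ℂ (AlgPoints.mapContinuous (L := ℂ) (Motives.sliceRight (1 : 𝟙_ (SchemeOver ℂ) ⟶ A.X) K)) ∘ₗ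
        totalPullback ℂ (AlgPoints.mapContinuous (L := ℂ) (kummerCover act j)) :=
  (hact.totalPullback_sliceOne_comp_kummerCover hH j).symm

include hc hdeck in
/-- **`R = im θ^*`** for the Kummer cover of a translation action on a Hilbert scheme of points of `A` (`K` smooth
projective): `⊇` — for `s ∈ R`, `1 × s = Θ^* w` and `θ^* w = (1, 𝟙)^*(1 × s) = s`; `⊆` — `θ^* w = (1, 𝟙)^*(Θ^* w)`
with `Θ^* w ∈ κ(H*(A) ⊗ R)` and `(1, 𝟙)^*(a × s) = c • s ∈ R`. -/
theorem fibreRange_eq_range {m : ℕ} (hA : IsSmoothProjective 2 A.X) (hK : IsSmoothProjective m K)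
    (hH : IsHilbertSchemeOfPoints n A.X H Ξ) (hact : IsTranslationAction Ξ act) :
    fibreRange A K (kummerCover act j) = LinearMap.range (totalPullback ℂ (AlgPoints.mapContinuous (L := ℂ) j)) := by
  refine le_antisymm (fun s hs ↦ ?_) ?_
  · obtain ⟨w, hw⟩ := (mem_fibreRange_iff _ s).1 hs
    refine ⟨w, ?_⟩
    rw [totalPullback_eq_sliceRight_comp hH hact j, LinearMap.comp_apply, hw]
    exact totalPullback_sliceRight_kunnethCross_one_tmul _ s
  · rintro _ ⟨w, rfl⟩
    rw [totalPullback_eq_sliceRight_comp hH hact j, LinearMap.comp_apply]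
    have hmem : totalPullback ℂ (AlgPoints.mapContinuous (L := ℂ) (kummerCover act j)) w ∈
        (tensorWith (totalCohomology ℂ (ComplexPoints A.X)) (fibreRange A K (kummerCover act j))).map
          (kunnethCross A.X K) :=
      range_le_map_tensorWith_fibreRange c hc hdeck hA hK ⟨w, rfl⟩
    obtain ⟨t, ht, hκt⟩ := hmem
    rw [← hκt]
    clear hκt
    -- `(1, 𝟙)^* (κ t) ∈ R` for `t ∈ H*(A) ⊗ R`
    induction ht using Submodule.span_induction with
    | mem t ht =>
      obtain ⟨a, s, hs, rfl⟩ := ht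
      obtain ⟨c', hc'⟩ := exists_totalPullback_sliceRight_kunnethCross hK (1 : 𝟙_ (SchemeOver ℂ) ⟶ A.X) a s
      change totalPullback ℂ _ (kunnethCross A.X K (a ⊗ₜ s)) ∈ fibreRange A K (kummerCover act j)
      rw [hc']
      exact Submodule.smul_mem _ _ hs
    | zero => rw [map_zero, map_zero]; exact Submodule.zero_mem _
    | add x y _ _ hx hy => rw [map_add, map_add]; exact Submodule.add_mem _ hx hy
    | smul r x _ hx => rw [map_smul, map_smul]; exact Submodule.smul_mem _ r hx

include hc hdeck in
/-- **`im Θ^* = κ(H*(A) ⊗ im θ^*)`** — the cohomological form of Beauville's isotrivial square / Kapfer–Menet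
Lemma 5.4 ("`Θ^* : H*(A^[n]) ≅ (H*(K) ⊗ H*(A))^{A[n]}`, `im θ^* = H*(K)^{A[n]}`") that V0 consumes. -/
theorem range_totalPullback_kummerCover_eq {m : ℕ} (hA : IsSmoothProjective 2 A.X) (hK : IsSmoothProjective m K)
    (hH : IsHilbertSchemeOfPoints n A.X H Ξ) (hact : IsTranslationAction Ξ act) :
    LinearMap.range (totalPullback ℂ (AlgPoints.mapContinuous (L := ℂ) (kummerCover act j))) =
      (tensorWith (totalCohomology ℂ (ComplexPoints A.X))
        (LinearMap.range (totalPullback ℂ (AlgPoints.mapContinuous (L := ℂ) j)))).map (kunnethCross A.X K) := by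
  rw [← fibreRange_eq_range c hc hdeck hA hK hH hact, range_totalPullback_eq c hc hdeck hA hK]

include hc in
/-- **`Θ^*` is injective** on `H*(H(ℂ); ℂ)`. -/
theorem totalPullback_kummerCover_injective :
    Function.Injective (totalPullback ℂ (AlgPoints.mapContinuous (L := ℂ) (kummerCover act j))) := by
  rw [← hc]
  exact totalPullback_proj_injective c

end FibreRangeEqRange

end Summit.Ventures.HodgeKum4.HilbertKummer

end
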